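import Literature.AnabelianGeometry.AbsoluteAnabelian.AbsTopIII.DivisorSectionsWellDefined
import HarnessLib

/-!
# [AbsTopIII] Prop. 1.6 (ii): the section `t_D` and "coincides up to conjugation by `Δ_X`" (FACT-LIST F-0351)

S. Mochizuki, *Topics in absolute anabelian geometry III: global reconstruction algorithms*
[MochizukiAbsTopIII2015]; kurims manuscript pages (`paper:url-5493eb38cbb7`): Prop. 1.6 (ii) p. 35.

PROOF-ONLY companion (no definition, no instance) of `AbsTopIII/DivisorSections.lean` (abc-iut-L4-t1
lineage) and `DivisorSectionsWellDefined.lean` (FACT-LIST row **F-0351**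
`AbsTopIII.DivisorCurveModel.Prop_1_6_ii`; abc-iut cell seat abc-iut-f-080, block F).

Print compares the SECTION "`t_D : G_k → Π_J`" of a degree-zero divisor with "the section determined
by the identity element `∈ J(k)`", "[up to conjugation by `Δ_X`]"; the trunk compares COCYCLES
(`IsPrincipalCocycle s₀ (divisorCocycle …)`).  This file supplies the dictionary between the two:

* `sectionDiff_mul_cocycle`, `divisorCocycle_mul_cocycle` — the differences `δ(s,s₀) = t_s t₀⁻¹` and the
  divisor cocycle `c_D` are `1`-cocycles for the `G`-action on `Δ^ab` through `s₀`;
* `exists_section_of_cocycle`, `exists_divisorSection` — a `1`-cocycle `c` twists the base section into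
  a genuine section `σ ↦ c(σ) · t₀(σ)` of `Π_{J¹} ↠ G`; so "`t_D`" EXISTS as a section, realised inside
  `Π_{J¹}` relative to `t₀` (i.e. under the translation `J ≅ J¹` by the base point, under which the
  identity section becomes `t₀`);
* `isPrincipalCocycle_iff_exists_conj` — `IsPrincipalCocycle s₀ c` says LITERALLY that this twisted
  section is conjugate to `t₀` by an element of `Δ^ab` (the image of `Δ_X` in `Π_{J¹}`), i.e. print's
  "coincides [up to conjugation by `Δ_X`]"; model form
  `DivisorCurveModel.isPrincipalCocycle_divisorCocycleOf_iff_exists_conj`.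

Together with `DivisorSectionsWellDefined.lean` (independence of the base point and of the
representatives `s_x`) this certifies that the typed left-hand side of `Prop_1_6_ii` is print's
condition.  Refereed pre-IUT material; nothing here bears on [IUTchIII] Cor. 3.12 or takes a side;
typed ≠ proved.
-/

noncomputable section

open scoped Classical IsMulCommutative

namespace Literature.AnabelianGeometry.AbsoluteAnabelian.AbsTopIII

universe u

variable {E : FundamentalExtension.{u}}

/-! ### The differences and the divisor cocycle are `1`-cocycles -/

/-- The difference `δ(s,s₀)` is a `1`-cocycle for the `G`-action through `s₀`:
`δ(στ) = δ(σ) · (σ·δ(τ))`. [cite: MochizukiAbsTopIII2015, Prop 1.6 (ii) p.35] -/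
theorem sectionDiff_mul_cocycle (s s₀ : E.Section) (σ τ : E.gal) :
    sectionDiff s s₀ (σ * τ) = sectionDiff s s₀ σ * sectionAct s₀ σ (sectionDiff s s₀ τ) := by
  apply Subtype.ext
  simp only [Subgroup.coe_mul, coe_sectionDiff, coe_sectionAct, map_mul, mul_inv_rev]
  group

/-- **The divisor cocycle is a `1`-cocycle** (products of powers of cocycles with abelian coefficients).
[cite: MochizukiAbsTopIII2015, Prop 1.6 (ii) p.35] -/
theorem divisorCocycle_mul_cocycle {ι : Type u} [Fintype ι] (n : ι → ℤ) (s : ι → E.Section)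
    (s₀ : E.Section) (σ τ : E.gal) :
    divisorCocycle n s s₀ (σ * τ) =
      divisorCocycle n s s₀ σ * sectionAct s₀ σ (divisorCocycle n s s₀ τ) := by
  simp only [divisorCocycle, map_prod, map_zpow, ← Finset.prod_mul_distrib, ← mul_zpow,
    ← sectionDiff_mul_cocycle]

/-! ### Twisting the base section by a cocycle: the section `t_D` -/

/-- **A `1`-cocycle twists the base section into a section**: for `c` with
`c(στ) = c(σ) · (σ·c(τ))`, the map `σ ↦ c(σ) · t₀(σ)` is a group homomorphism `G → Π_{J¹}` splitting
the augmentation `Π_{J¹} ↠ G`. [cite: MochizukiAbsTopIII2015, Prop 1.6 (ii) p.35] -/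
theorem exists_section_of_cocycle (s₀ : E.Section) (c : E.gal → geomAbelianized E)
    (hc : ∀ σ τ, c (σ * τ) = c σ * sectionAct s₀ σ (c τ)) :
    ∃ t : E.gal →* PiJ1 E, (∀ σ, augJ1 E (t σ) = σ) ∧
      ∀ σ, t σ = (c σ : PiJ1 E) * sectionJ1 s₀ σ := by
  have h1 : c 1 = 1 := by
    have h := hc 1 1
    rw [mul_one] at h
    have hact : sectionAct s₀ 1 (c 1) = c 1 :=
      Subtype.ext (by rw [coe_sectionAct, map_one, one_mul, inv_one, mul_one])
    rw [hact] at h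
    exact mul_eq_left.mp h.symm
  refine ⟨{ toFun := fun σ => (c σ : PiJ1 E) * sectionJ1 s₀ σ, map_one' := ?_, map_mul' := ?_ },
    fun σ => ?_, fun σ => rfl⟩
  · show (c 1 : PiJ1 E) * sectionJ1 s₀ 1 = 1
    rw [h1, map_one, Subgroup.coe_one, one_mul]
  · intro σ τ
    show (c (σ * τ) : PiJ1 E) * sectionJ1 s₀ (σ * τ) =
      (c σ : PiJ1 E) * sectionJ1 s₀ σ * ((c τ : PiJ1 E) * sectionJ1 s₀ τ)
    rw [hc, Subgroup.coe_mul, coe_sectionAct, map_mul]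
    group
  · show augJ1 E ((c σ : PiJ1 E) * sectionJ1 s₀ σ) = σ
    rw [map_mul, (mem_geomAbelianized_iff E _).mp (c σ).2, one_mul, augJ1_sectionJ1]

/-- **The section "`t_D`"** ("forming the appropriate `ℤ`-linear combination of '`t_x`'s' [...] yields
a section `t_D`", p. 35), for the typed degree-zero situation, realised inside `Π_{J¹}` relative to the
base section: `σ ↦ c_D(σ) · t₀(σ)` is a homomorphism splitting `Π_{J¹} ↠ G`.
[cite: MochizukiAbsTopIII2015, Prop 1.6 (ii) p.35] -/
theorem exists_divisorSection {ι : Type u} [Fintype ι] (n : ι → ℤ) (s : ι → E.Section)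
    (s₀ : E.Section) :
    ∃ t : E.gal →* PiJ1 E, (∀ σ, augJ1 E (t σ) = σ) ∧
      ∀ σ, t σ = (divisorCocycle n s s₀ σ : PiJ1 E) * sectionJ1 s₀ σ :=
  exists_section_of_cocycle s₀ _ (divisorCocycle_mul_cocycle n s s₀)

/-! ### `IsPrincipalCocycle` = "coincides up to conjugation by `Δ_X`" -/

/-- **Dictionary with print.**  `IsPrincipalCocycle s₀ c` holds iff the twisted section
`σ ↦ c(σ) · t₀(σ)` "coincides [up to conjugation by `Δ_X`]" (acting through its image `Δ^ab` in
`Π_{J¹}`) with the base section `t₀`: `c(σ) · t₀(σ) = a · t₀(σ) · a⁻¹` for some `a ∈ Δ^ab` and all `σ`.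
[cite: MochizukiAbsTopIII2015, Prop 1.6 (ii) p.35] -/
theorem isPrincipalCocycle_iff_exists_conj (s₀ : E.Section) (c : E.gal → geomAbelianized E) :
    IsPrincipalCocycle s₀ c ↔ ∃ a : geomAbelianized E, ∀ σ,
      (c σ : PiJ1 E) * sectionJ1 s₀ σ = (a : PiJ1 E) * sectionJ1 s₀ σ * (a : PiJ1 E)⁻¹ := by
  refine exists_congr fun a => forall_congr' fun σ => ?_
  constructor
  · intro h
    rw [h, Subgroup.coe_mul, Subgroup.coe_inv, coe_sectionAct]
    group
  · intro h
    apply Subtype.ext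
    rw [Subgroup.coe_mul, Subgroup.coe_inv, coe_sectionAct]
    calc (c σ : PiJ1 E) = (c σ : PiJ1 E) * sectionJ1 s₀ σ * (sectionJ1 s₀ σ)⁻¹ := by group
      _ = (a : PiJ1 E) * sectionJ1 s₀ σ * (a : PiJ1 E)⁻¹ * (sectionJ1 s₀ σ)⁻¹ := by rw [h]
      _ = (a : PiJ1 E) * (sectionJ1 s₀ σ * (a : PiJ1 E) * (sectionJ1 s₀ σ)⁻¹)⁻¹ := by group

/-- Conjugates of the base section by elements of `Δ^ab` are exactly the twists by coboundaries:
`a · t₀(σ) · a⁻¹ = (a · (σ·a)⁻¹) · t₀(σ)`. [cite: MochizukiAbsTopIII2015, Prop 1.6 (ii) p.35] -/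
theorem conj_sectionJ1_eq_coboundary_mul (s₀ : E.Section) (a : geomAbelianized E) (σ : E.gal) :
    (a : PiJ1 E) * sectionJ1 s₀ σ * (a : PiJ1 E)⁻¹ =
      ((a * (sectionAct s₀ σ a)⁻¹ : geomAbelianized E) : PiJ1 E) * sectionJ1 s₀ σ := by
  rw [Subgroup.coe_mul, Subgroup.coe_inv, coe_sectionAct]
  group

namespace DivisorCurveModel

variable (M : DivisorCurveModel.{u})

/-- **The typed LHS of `Prop_1_6_ii` in print's words**: `IsPrincipalCocycle s₀ (M.divisorCocycleOf D hD s₀)`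
holds iff the section `t_D : σ ↦ c_D(σ) · t₀(σ)` of `Π_{J¹} ↠ G` (`exists_divisorSection`) is conjugate
to the base section `t₀` by an element of `Δ^ab` — "`t_D` [...] coincides [up to conjugation by `Δ_X`]
with the section determined by" the base point. [cite: MochizukiAbsTopIII2015, Prop 1.6 (ii) p.35] -/
theorem isPrincipalCocycle_divisorCocycleOf_iff_exists_conj {X : M.Curve} (D : M.Point X →₀ ℤ)
    (hD : ∀ x ∈ D.support, M.IsRationalPt X x) (s₀ : (M.ext X).Section) :
    IsPrincipalCocycle s₀ (M.divisorCocycleOf D hD s₀) ↔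
      ∃ a : geomAbelianized (M.ext X), ∀ σ,
        (M.divisorCocycleOf D hD s₀ σ : PiJ1 (M.ext X)) * sectionJ1 s₀ σ =
          (a : PiJ1 (M.ext X)) * sectionJ1 s₀ σ * (a : PiJ1 (M.ext X))⁻¹ :=
  isPrincipalCocycle_iff_exists_conj s₀ _

/-- **The section `t_D` of a model's degree-zero divisor exists** as a homomorphism `G → Π_{J¹}`
splitting the augmentation, `σ ↦ c_D(σ) · t₀(σ)`. [cite: MochizukiAbsTopIII2015, Prop 1.6 (ii) p.35] -/
theorem exists_divisorSectionOf {X : M.Curve} (D : M.Point X →₀ ℤ)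
    (hD : ∀ x ∈ D.support, M.IsRationalPt X x) (s₀ : (M.ext X).Section) :
    ∃ t : (M.ext X).gal →* PiJ1 (M.ext X), (∀ σ, augJ1 (M.ext X) (t σ) = σ) ∧
      ∀ σ, t σ = (M.divisorCocycleOf D hD s₀ σ : PiJ1 (M.ext X)) * sectionJ1 s₀ σ :=
  exists_divisorSection _ _ s₀

end DivisorCurveModel

end Literature.AnabelianGeometry.AbsoluteAnabelian.AbsTopIII

end
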